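import Summits.CriticalPhenomena.SAWScalingLimit.Theorems.SAWMassiveIsingTiltLatticeUniversalityNoTightness
import HarnessLib

/-!
# Crux `LatticeUniversality` (stmt-CriticalPhenomena-0807), line `registered` (birth v4.3) — the monolayer glue
# `HexMonolayer → AdmissibleTips → (L*)`

Line lead c6 (prover-line-stmt-CriticalPhenomena-0807-c6-0, 2026-08-17), `--supports stmt-CriticalPhenomena-0807`.

Skeleton v4.3 (`Cruxes/LatticeUniversality/Lines/birth.lean`) makes the abstract stub (L*) `HexLayerRobust` ("for
every chordal `P` with `RL(π/3) P` and every Dobrushin domain `D`, SOME hexagonal endpoint approximation of `D` has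
σ-pushed vertex-convention critical hexagonal laws converging in law to `P (σD)`") CONCRETE as

  (MONO) `stub_hexMonolayer` + (TIPS) `stub_admissibleTips` + THIS glue (`stub_monolayerGlue`).

Here `σ z = i z`, `S_δ(D) = σD − iδ/2` are the rotated, half-shifted moving domains of the Glazman–Manolescu relay,
the tips are the boundary-triangle tips `bdryVertex … (a' δ)`, `bdryVertex … (b' δ)` of boundary mid-edges `a' δ, b' δ`
of the face sets of `S_δ(D)`. MONO says: if the tips form an admissible hexagonal endpoint approximation of `D`, the
critical hexagonal chordal laws of the FACE DOMAIN of `S_δ(D)` and of `D` itself, both between the same tips, merge on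
bounded `1`-Lipschitz test functions; TIPS says such `(a', b')` exist.

The proof is the landed `tendstoLaw_hexLaw_of_allForm_robustThird` (p156087: K2∀ → RL(π/3) P → (HexVL)) run on
the DIAGONAL `(a, b) := tips`:
* `hexThirdShiftBL_at` — the POINTWISE convention bridge (the body of `hexThirdShiftBL_of_microRobust`, p144803,
  for ONE domain, ONE vertex approximation `(a, b)` and ONE boundary mid-edge approximation `(a', b')`): merging of the
  face-domain law (tips) with the `D`-law (`a δ, b δ`) on bounded `1`-Lipschitz functions gives merging of the GM `π/3`
  law of `S_δ(D)` between `a' δ, b' δ` with the `S_δ`-image of the `D`-law (exact `π/3` dictionary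
  `stub_gmHexDictionary`, `≤ 2δ`; `S_δ ↔ σ`, `≤ δ/2` twice; all free for Lipschitz `f`). Reusable.
* `stub_monolayerGlue` — MONO at the tips of TIPS feeds `hexThirdShiftBL_at`; `RL(π/3)` at `u δ = −iδ/2`
  (`eventually_norm_halfShift_le`) makes the GM side converge to `P (σD)`; the displacement bracket and the
  convergent upgrade `tendsto_integral_sub_of_tendstoLaw` (p153935) finish, verbatim as in p156087.
Sources: A. Glazman, I. Manolescu, arXiv:1708.00395 §1 p. 3, Fig. 2; A. D'Aristotile, P. Diaconis, D. Freedman,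
*On merging of probabilities* (1988).
-/

noncomputable section

namespace Summit.CriticalPhenomena.SAWScalingLimit.Cruxes.LatticeUniversality.Birth

open MeasureTheory Filter Topology Set
open scoped NNReal ENNReal BoundedContinuousFunction
open Complex (I I_ne_zero)
open Literature.Probability.RandomPlanarGeometry
open Literature.Probability.RandomPlanarGeometry.SAW
open Literature.Probability.RandomPlanarGeometry.SAW.YangBaxter
open Literature.Probability.LatticeModels (Site HexVertex hexGraph hexCenter)
open Summit.CriticalPhenomena.SAWScalingLimit.Theses
open Summit.CriticalPhenomena.SAWScalingLimit.Cruxes.HexTransfer.YbRelay (third IsBdryEdge bdryVertex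
  faceDomain gmSimilarity stub_gmHexDictionary)
open Summit.CriticalPhenomena.SAWScalingLimit.Theorems.ObservableToSLE.Negative
  (eventually_isProbabilityMeasure_hexSAWLaw)

/-! ### The pointwise convention bridge -/

/-- **The convention bridge, pointwise.** Fix a Dobrushin domain `D`, hexagonal endpoints `a δ, b δ` and boundary
mid-edges `a' δ ≠ b' δ` of the face sets of the moving domains `S_δ(D) = σD − iδ/2`, eventually joined by a
Glazman–Manolescu walk. If the critical hexagonal law of the FACE DOMAIN of `S_δ(D)` between the boundary-triangle
tips of `a' δ, b' δ` and the critical hexagonal law of `D` between `a δ, b δ` merge on bounded `1`-Lipschitz test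
functions, then so do the critical GM `π/3` law of `S_δ(D)` between `a' δ, b' δ` (drawn curves) and the `S_δ`-image of
the law of `D`: the GM law IS the push-forward of the face-domain law along a map moving drawn curves by `≤ 2δ` from
their `S_δ`-images (`stub_gmHexDictionary`), and `S_δ ↔ σ` costs `≤ δ/2` twice — all free for Lipschitz `f`.
(The body of `hexThirdShiftBL_of_microRobust` for one `(D, a, b, a', b')`.)
[cite: GlazmanManolescu2019, §1 p. 3 and Fig. 2] -/
theorem hexThirdShiftBL_at (D : DobrushinDomain) (a b : ℝ → HexVertex) (a' b' : ℝ → MidEdge)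
    (hev : ∀ᶠ δ in 𝓝[>] (0 : ℝ), a' δ ≠ b' δ ∧
      IsBdryEdge (meshFaces third (((D.map (similarity I I_ne_zero 0)).map
        (similarity 1 one_ne_zero (-(I * (δ : ℂ) / 2)))).carrier) δ) (a' δ) ∧
      IsBdryEdge (meshFaces third (((D.map (similarity I I_ne_zero 0)).map
        (similarity 1 one_ne_zero (-(I * (δ : ℂ) / 2)))).carrier) δ) (b' δ) ∧
      Nonempty (YangBaxterSAW third (((D.map (similarity I I_ne_zero 0)).map
        (similarity 1 one_ne_zero (-(I * (δ : ℂ) / 2)))).carrier) δ (a' δ) (b' δ)))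
    (hM : ∀ f : BoundedContinuousFunction (CurveClass ℂ) ℝ, LipschitzWith 1 f →
      Tendsto (fun δ : ℝ => (∫ γ, f γ.curve ∂(SAW.hexSAWLaw
          (faceDomain (((D.map (similarity I I_ne_zero 0)).map
            (similarity 1 one_ne_zero (-(I * (δ : ℂ) / 2)))).carrier) δ (a' δ)) δ
          (bdryVertex (meshFaces third (((D.map (similarity I I_ne_zero 0)).map
            (similarity 1 one_ne_zero (-(I * (δ : ℂ) / 2)))).carrier) δ) (a' δ))
          (bdryVertex (meshFaces third (((D.map (similarity I I_ne_zero 0)).map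
            (similarity 1 one_ne_zero (-(I * (δ : ℂ) / 2)))).carrier) δ) (b' δ)))) -
        ∫ γ, f γ.curve ∂(SAW.hexSAWLaw D.carrier δ (a δ) (b δ))) (𝓝[>] (0 : ℝ)) (𝓝 0)) :
    ∀ f : BoundedContinuousFunction (CurveClass ℂ) ℝ, LipschitzWith 1 f →
      Tendsto (fun δ : ℝ => (∫ γ, f (γ.curve third δ)
          ∂(ybLaw third (((D.map (similarity I I_ne_zero 0)).map
            (similarity 1 one_ne_zero (-(I * (δ : ℂ) / 2)))).carrier) δ 1 (a' δ) (b' δ))) -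
        ∫ γ, f (CurveClass.map (gmSimilarity δ : C(ℂ, ℂ)) γ.curve) ∂(SAW.hexSAWLaw D.carrier δ (a δ) (b δ)))
        (𝓝[>] (0 : ℝ)) (𝓝 0) := by
  intro f hf
  -- the merging hypothesis tested on the `1`-Lipschitz function `f ∘ σ`
  have hσL : LipschitzWith 1 (CurveClass.map (similarity I I_ne_zero 0 : C(ℂ, ℂ))) := by
    simpa using CurveClass.lipschitzWith_map (lipschitzWith_similarity I I_ne_zero 0)
  set fσ : BoundedContinuousFunction (CurveClass ℂ) ℝ :=
    f.compContinuous ⟨CurveClass.map (similarity I I_ne_zero 0 : C(ℂ, ℂ)), hσL.continuous⟩ with hfσ_def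
  have hfσ : LipschitzWith 1 fσ := by
    simpa [hfσ_def] using hf.comp hσL
  have hC := hM fσ hfσ
  -- the remaining three brackets are `O(δ)`, eventually
  have hsmall : ∀ᶠ δ : ℝ in 𝓝[>] (0 : ℝ),
      |((∫ γ, f (γ.curve third δ)
            ∂(ybLaw third (((D.map (similarity I I_ne_zero 0)).map
                (similarity 1 one_ne_zero (-(I * (δ : ℂ) / 2)))).carrier) δ 1 (a' δ) (b' δ))) -
          ∫ γ, f (CurveClass.map (gmSimilarity δ : C(ℂ, ℂ)) γ.curve)
            ∂(SAW.hexSAWLaw D.carrier δ (a δ) (b δ))) -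
        ((∫ γ, fσ γ.curve ∂(SAW.hexSAWLaw
            (faceDomain (((D.map (similarity I I_ne_zero 0)).map
              (similarity 1 one_ne_zero (-(I * (δ : ℂ) / 2)))).carrier) δ (a' δ)) δ
            (bdryVertex (meshFaces third (((D.map (similarity I I_ne_zero 0)).map
              (similarity 1 one_ne_zero (-(I * (δ : ℂ) / 2)))).carrier) δ) (a' δ))
            (bdryVertex (meshFaces third (((D.map (similarity I I_ne_zero 0)).map
              (similarity 1 one_ne_zero (-(I * (δ : ℂ) / 2)))).carrier) δ) (b' δ)))) -
          ∫ γ, fσ γ.curve ∂(SAW.hexSAWLaw D.carrier δ (a δ) (b δ)))| ≤ 3 * δ := by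
    filter_upwards [hev, self_mem_nhdsWithin] with δ hδe hδ
    obtain ⟨hne, hba, hbb, hnon⟩ := hδe
    have hδ0 : (0 : ℝ) < δ := hδ
    obtain ⟨φ, hlaw, hdist⟩ := stub_gmHexDictionary _ δ hδ0 (a' δ) (b' δ) hne hba hbb hnon
    -- (A) transport the GM integral along the dictionary and pay `2δ`
    have hA : |(∫ γ, f (γ.curve third δ)
          ∂(ybLaw third (((D.map (similarity I I_ne_zero 0)).map
              (similarity 1 one_ne_zero (-(I * (δ : ℂ) / 2)))).carrier) δ 1 (a' δ) (b' δ))) -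
        ∫ γ, f (CurveClass.map (gmSimilarity δ : C(ℂ, ℂ)) γ.curve) ∂(SAW.hexSAWLaw
            (faceDomain (((D.map (similarity I I_ne_zero 0)).map
              (similarity 1 one_ne_zero (-(I * (δ : ℂ) / 2)))).carrier) δ (a' δ)) δ
            (bdryVertex (meshFaces third (((D.map (similarity I I_ne_zero 0)).map
              (similarity 1 one_ne_zero (-(I * (δ : ℂ) / 2)))).carrier) δ) (a' δ))
            (bdryVertex (meshFaces third (((D.map (similarity I I_ne_zero 0)).map
              (similarity 1 one_ne_zero (-(I * (δ : ℂ) / 2)))).carrier) δ) (b' δ)))| ≤ 2 * δ := by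
      rw [hlaw, integral_map (SAW.EmbDomainSAW.measurable_of_top φ).aemeasurable
        (YBWalk.measurable_of_top _).aestronglyMeasurable]
      exact abs_integral_sub_integral_le_of_dist_le _ (hexSAWLaw_univ_le_one _ _ _ _) f hf
        (by positivity) hdist (SAW.EmbDomainSAW.measurable_of_top _).aestronglyMeasurable
        (SAW.EmbDomainSAW.measurable_of_top _).aestronglyMeasurable
    -- (B) `S_δ ↦ σ` on the face-domain side, (D) `σ ↦ S_δ` on the `D` side: `δ/2` each
    have hB := abs_integral_shift_sub_le hδ0.le (Ω := faceDomain (((D.map (similarity I I_ne_zero 0)).map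
        (similarity 1 one_ne_zero (-(I * (δ : ℂ) / 2)))).carrier) δ (a' δ))
      (a := bdryVertex (meshFaces third (((D.map (similarity I I_ne_zero 0)).map
        (similarity 1 one_ne_zero (-(I * (δ : ℂ) / 2)))).carrier) δ) (a' δ))
      (b := bdryVertex (meshFaces third (((D.map (similarity I I_ne_zero 0)).map
        (similarity 1 one_ne_zero (-(I * (δ : ℂ) / 2)))).carrier) δ) (b' δ)) f hf
    have hD := abs_integral_shift_sub_le hδ0.le (Ω := D.carrier) (a := a δ) (b := b δ) f hf
    -- `fσ ∘ curve = f ∘ σ ∘ curve`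
    simp only [hfσ_def, BoundedContinuousFunction.compContinuous_apply, ContinuousMap.coe_mk]
    rw [abs_le] at hA hB hD ⊢
    constructor <;> linarith [hA.1, hA.2, hB.1, hB.2, hD.1, hD.2]
  -- conclude: the difference to the merging bracket is `O(δ)`, the bracket tends to `0`
  have h3δ : Tendsto (fun δ : ℝ => 3 * δ) (𝓝[>] (0 : ℝ)) (𝓝 0) := by
    have h : Tendsto (fun δ : ℝ => 3 * δ) (𝓝 (0 : ℝ)) (𝓝 (3 * 0)) := tendsto_id.const_mul 3
    rw [mul_zero] at h
    exact tendsto_nhdsWithin_of_tendsto_nhds h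
  have hdiff := squeeze_zero_norm' (hsmall.mono fun δ h => le_of_eq_of_le (Real.norm_eq_abs _) h) h3δ
  have h := hdiff.add hC
  rw [add_zero] at h
  exact h.congr fun δ => by ring

/-! ### The glue: `HexMonolayer → AdmissibleTips → (L*)` -/

/-- **The monolayer glue `HexMonolayer → AdmissibleTips → (L*)`** (skeleton v4.3, stub 1d; hypotheses = the registered
stubs `stub_hexMonolayer`, `stub_admissibleTips` written out; conclusion = (L*) `HexLayerRobust` written out). For a
chordal `P` with `RL(π/3) P` and a Dobrushin domain `D`, take the boundary mid-edges `(a', b')` of TIPS; their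
boundary-triangle tips ARE the good hexagonal endpoint approximation of `D`: MONO at the tips and the pointwise convention
bridge `hexThirdShiftBL_at` merge `σ_* P^{Hex}_δ(D; tips)` (up to the free `iδ/2` displacement,
`abs_integral_shift_sub_le`) with the GM `π/3` laws of `S_δ(D) = σD − iδ/2` between `a' δ, b' δ` on bounded `1`-Lipschitz
functions; these converge to `P (σD)` by `RL(π/3)` at `u δ = −iδ/2` (`eventually_norm_halfShift_le`); the convergent
upgrade `tendsto_integral_sub_of_tendstoLaw` finishes — the proof of `tendstoLaw_hexLaw_of_allForm_robustThird` run on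
the diagonal. [folklore] -/
theorem stub_monolayerGlue : (∀ (D : DobrushinDomain) (a' b' : ℝ → MidEdge), (∀ᶠ δ in 𝓝[>] (0 : ℝ), a' δ ≠ b' δ ∧ IsBdryEdge (meshFaces third (((D.map (similarity I I_ne_zero 0)).map (similarity 1 one_ne_zero (-(I * (δ : ℂ) / 2)))).carrier) δ) (a' δ) ∧ IsBdryEdge (meshFaces third (((D.map (similarity I I_ne_zero 0)).map (similarity 1 one_ne_zero (-(I * (δ : ℂ) / 2)))).carrier) δ) (b' δ) ∧ Nonempty (YangBaxterSAW third (((D.map (similarity I I_ne_zero 0)).map (similarity 1 one_ne_zero (-(I * (δ : ℂ) / 2)))).carrier) δ (a' δ) (b' δ))) → Tendsto (fun δ : ℝ => (δ : ℂ) * planeMidpoint third (a' δ)) (𝓝[>] (0 : ℝ)) (𝓝 ((D.map (similarity I I_ne_zero 0)).pt 0)) → Tendsto (fun δ : ℝ => (δ : ℂ) * planeMidpoint third (b' δ)) (𝓝[>] (0 : ℝ)) (𝓝 ((D.map (similarity I I_ne_zero 0)).pt 1)) → SAW.IsEmbEndpointApprox hexGraph hexCenter D (fun δ => (bdryVertex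 (meshFaces third (((D.map (similarity I I_ne_zero 0)).map (similarity 1 one_ne_zero (-(I * (δ : ℂ) / 2)))).carrier) δ) (a' δ))) (fun δ => (bdryVertex (meshFaces third (((D.map (similarity I I_ne_zero 0)).map (similarity 1 one_ne_zero (-(I * (δ : ℂ) / 2)))).carrier) δ) (b' δ))) → ∀ f : BoundedContinuousFunction (CurveClass ℂ) ℝ, LipschitzWith 1 f → Tendsto (fun δ : ℝ => (∫ γ, f γ.curve ∂(SAW.hexSAWLaw (faceDomain (((D.map (similarity I I_ne_zero 0)).map (similarity 1 one_ne_zero (-(I * (δ : ℂ) / 2)))).carrier) δ (a' δ)) δ (bdryVertex (meshFaces third (((D.map (similarity I I_ne_zero 0)).map (similarity 1 one_ne_zero (-(I * (δ : ℂ) / 2)))).carrier) δ) (a' δ)) (bdryVertex (meshFaces third (((D.map (similarity I I_ne_zero 0)).map (similarity 1 one_ne_zero (-(I * (δ : ℂ) / 2)))).carrier) δ) (b' δ)))) - ∫ γ, f γ.curve ∂(SAW.hexSAWLaw D.carrier δ (bdryVertex (meshFaces third (((D.map (similarity I I_ne_zero 0)).map (similarity 1 one_ne_zero (-(I * (δ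 : ℂ) / 2)))).carrier) δ) (a' δ)) (bdryVertex (meshFaces third (((D.map (similarity I I_ne_zero 0)).map (similarity 1 one_ne_zero (-(I * (δ : ℂ) / 2)))).carrier) δ) (b' δ)))) (𝓝[>] (0 : ℝ)) (𝓝 0)) → (∀ D : DobrushinDomain, ∃ a' b' : ℝ → MidEdge, (∀ᶠ δ in 𝓝[>] (0 : ℝ), a' δ ≠ b' δ ∧ IsBdryEdge (meshFaces third (((D.map (similarity I I_ne_zero 0)).map (similarity 1 one_ne_zero (-(I * (δ : ℂ) / 2)))).carrier) δ) (a' δ) ∧ IsBdryEdge (meshFaces third (((D.map (similarity I I_ne_zero 0)).map (similarity 1 one_ne_zero (-(I * (δ : ℂ) / 2)))).carrier) δ) (b' δ) ∧ Nonempty (YangBaxterSAW third (((D.map (similarity I I_ne_zero 0)).map (similarity 1 one_ne_zero (-(I * (δ : ℂ) / 2)))).carrier) δ (a' δ) (b' δ))) ∧ Tendsto (fun δ : ℝ => (δ : ℂ) * planeMidpoint third (a' δ)) (𝓝[>] (0 : ℝ)) (𝓝 ((D.map (similarity I I_ne_zero 0)).pt 0)) ∧ Tendsto (fun δ : ℝ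 => (δ : ℂ) * planeMidpoint third (b' δ)) (𝓝[>] (0 : ℝ)) (𝓝 ((D.map (similarity I I_ne_zero 0)).pt 1)) ∧ SAW.IsEmbEndpointApprox hexGraph hexCenter D (fun δ => (bdryVertex (meshFaces third (((D.map (similarity I I_ne_zero 0)).map (similarity 1 one_ne_zero (-(I * (δ : ℂ) / 2)))).carrier) δ) (a' δ))) (fun δ => (bdryVertex (meshFaces third (((D.map (similarity I I_ne_zero 0)).map (similarity 1 one_ne_zero (-(I * (δ : ℂ) / 2)))).carrier) δ) (b' δ)))) → ∀ P : ChordalFamily, P.IsChordal → (∀ (D : DobrushinDomain) (u : ℝ → ℂ) (a b : ℝ → MidEdge), (∀ᶠ δ in 𝓝[>] (0 : ℝ), ‖u δ‖ ≤ δ) → (∀ᶠ δ in 𝓝[>] (0 : ℝ), Nonempty (YangBaxterSAW (fun (_ : ℤ) => Real.pi / 3) ((D.map (similarity 1 one_ne_zero (u δ))).carrier) δ (a δ) (b δ))) → Tendsto (fun δ : ℝ => (δ : ℂ) * planeMidpoint (fun (_ : ℤ) => Real.pi / 3) (a δ)) (𝓝[>] (0 : ℝ)) (𝓝 (D.pt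 0)) → Tendsto (fun δ : ℝ => (δ : ℂ) * planeMidpoint (fun (_ : ℤ) => Real.pi / 3) (b δ)) (𝓝[>] (0 : ℝ)) (𝓝 (D.pt 1)) → TendstoLaw (fun δ (γ : YangBaxterSAW (fun (_ : ℤ) => Real.pi / 3) ((D.map (similarity 1 one_ne_zero (u δ))).carrier) δ (a δ) (b δ)) => γ.curve (fun (_ : ℤ) => Real.pi / 3) δ) (fun δ => ybLaw (fun (_ : ℤ) => Real.pi / 3) ((D.map (similarity 1 one_ne_zero (u δ))).carrier) δ 1 (a δ) (b δ)) id (P D)) → ∀ D : DobrushinDomain, ∃ a b : ℝ → HexVertex, SAW.IsEmbEndpointApprox hexGraph hexCenter D a b ∧ TendstoLaw (fun δ (γ : SAW.HexDomainSAW D.carrier δ (a δ) (b δ)) => CurveClass.map (similarity I I_ne_zero 0 : C(ℂ, ℂ)) γ.curve) (fun δ => SAW.hexSAWLaw D.carrier δ (a δ) (b δ)) id (P (D.map (similarity I I_ne_zero 0))) := by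
  intro hMono hTips P hPch hRL3 D
  obtain ⟨a', b', hev, hta, htb, hadm⟩ := hTips D
  refine ⟨_, _, hadm, ?_⟩
  intro g
  haveI : IsProbabilityMeasure (P (D.map (similarity I I_ne_zero 0))) := (hPch _).1
  -- the pointwise convention bridge fed by MONO at the tips
  have hH := hexThirdShiftBL_at D _ _ a' b' hev (hMono D a' b' hev hta htb hadm)
  -- the `π/3` laws of `S_δ(D)` between `a' δ, b' δ` converge to `P (σD)` (robustness at `u δ = −iδ/2`)
  have hconv3 := hRL3 (D.map (similarity I I_ne_zero 0)) (fun δ : ℝ => -(I * (δ : ℂ) / 2)) a' b'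
    eventually_norm_halfShift_le (hev.mono fun δ h => h.2.2.2) hta htb
  -- bounded-Lipschitz merging of `σ_* P^{Hex}_δ(D; tips)` with those laws
  have hBL : ∀ φ : BoundedContinuousFunction (CurveClass ℂ) ℝ, LipschitzWith 1 φ →
      Tendsto (fun δ : ℝ =>
          (∫ γ, φ (CurveClass.map (similarity I I_ne_zero 0 : C(ℂ, ℂ)) γ.curve)
              ∂(SAW.hexSAWLaw D.carrier δ
                (bdryVertex (meshFaces third (((D.map (similarity I I_ne_zero 0)).map
                  (similarity 1 one_ne_zero (-(I * (δ : ℂ) / 2)))).carrier) δ) (a' δ))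
                (bdryVertex (meshFaces third (((D.map (similarity I I_ne_zero 0)).map
                  (similarity 1 one_ne_zero (-(I * (δ : ℂ) / 2)))).carrier) δ) (b' δ)))) -
            ∫ γ, φ (γ.curve (fun (_ : ℤ) => Real.pi / 3) δ)
              ∂(ybLaw (fun (_ : ℤ) => Real.pi / 3)
                  (((D.map (similarity I I_ne_zero 0)).map
                    (similarity 1 one_ne_zero ((fun δ : ℝ => -(I * (δ : ℂ) / 2)) δ))).carrier) δ 1
                  (a' δ) (b' δ)))
        (𝓝[>] (0 : ℝ)) (𝓝 0) := by
    intro φ hφ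
    -- the displacement bracket `S_δ ↔ σ`, squeezed by `δ/2`
    have hS : Tendsto (fun δ : ℝ =>
        (∫ γ, φ (CurveClass.map (gmSimilarity δ : C(ℂ, ℂ)) γ.curve)
            ∂(SAW.hexSAWLaw D.carrier δ
              (bdryVertex (meshFaces third (((D.map (similarity I I_ne_zero 0)).map
                (similarity 1 one_ne_zero (-(I * (δ : ℂ) / 2)))).carrier) δ) (a' δ))
              (bdryVertex (meshFaces third (((D.map (similarity I I_ne_zero 0)).map
                (similarity 1 one_ne_zero (-(I * (δ : ℂ) / 2)))).carrier) δ) (b' δ)))) -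
          ∫ γ, φ (CurveClass.map (similarity I I_ne_zero 0 : C(ℂ, ℂ)) γ.curve)
            ∂(SAW.hexSAWLaw D.carrier δ
              (bdryVertex (meshFaces third (((D.map (similarity I I_ne_zero 0)).map
                (similarity 1 one_ne_zero (-(I * (δ : ℂ) / 2)))).carrier) δ) (a' δ))
              (bdryVertex (meshFaces third (((D.map (similarity I I_ne_zero 0)).map
                (similarity 1 one_ne_zero (-(I * (δ : ℂ) / 2)))).carrier) δ) (b' δ))))
        (𝓝[>] (0 : ℝ)) (𝓝 0) := by
      have h0 : Tendsto (fun δ : ℝ => δ / 2) (𝓝[>] (0 : ℝ)) (𝓝 0) := by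
        have h : Tendsto (fun δ : ℝ => δ / 2) (𝓝 (0 : ℝ)) (𝓝 (0 / 2)) := tendsto_id.div_const 2
        rw [zero_div] at h
        exact tendsto_nhdsWithin_of_tendsto_nhds h
      refine squeeze_zero_norm' ?_ h0
      filter_upwards [self_mem_nhdsWithin] with δ hδ
      exact le_of_eq_of_le (Real.norm_eq_abs _) (abs_integral_shift_sub_le (le_of_lt hδ) φ hφ)
    have h := (hH φ hφ).add hS
    rw [add_zero] at h
    have h' := h.neg
    rw [neg_zero] at h'
    exact h'.congr fun δ => by simp only; ring
  -- the convergent upgrade, then add back the convergence of the `π/3` side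
  have hXY := tendsto_integral_sub_of_tendstoLaw (eventually_isProbabilityMeasure_hexSAWLaw hadm)
    (fun δ => SAW.EmbDomainSAW.measurable_of_top _) aemeasurable_id hconv3 hBL g
  have h := hXY.add (hconv3 g)
  rw [zero_add] at h
  exact h.congr fun δ => sub_add_cancel _ _

end Summit.CriticalPhenomena.SAWScalingLimit.Cruxes.LatticeUniversality.Birth

end
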